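import Summits.BirchSwinnertonDyer.BirchSwinnertonDyer.Theorems.TwinTransportX9RungSchemaTwoStep
import Summits.BirchSwinnertonDyer.BirchSwinnertonDyer.Theorems.SignedBalanceX9TwistedAnalyticMuZeroCoprimeX9QuadFieldSplittingBridge
import Literature.NumberTheory.EllipticCurves.CyclotomicIwasawaMainTheoremIrreducibleAuxiliaryFieldsProofs
import Literature.NumberTheory.QuadraticFields.ImaginaryQuadraticPrescribedSplitting
import Literature.NumberTheory.EllipticCurves.NonEisensteinPrimeOfSurjective
import Literature.NumberTheory.EllipticCurves.GlobalMinimalModelProofs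

/-!
# Route `TwinTransportX9` — the FRAME SUPPLY of the deciding crux `TrivialTwinSupplyX9` (item 24080), class-wide

The crux body at `(W, p)` asks for a BCS-admissible pair `(d_K, d_F)` (`BCSAdmissiblePair`: conditions
(disc)/(Heeg)/(spl)/(i)/(ii)/(iii)/(vi) of Burungale–Castella–Skinner 2025 §1.2, Prop. 5.2.1, in the route's
RESIDUE currency `SplitsInQuadField` / `InertInQuadField`) and a globally minimal twin `W₁ ≅ W^{(d_K)}` with
a certificate (`r_an(W₁) = 0`, `p ∤ #Ш·∏c_ℓ·#tors`, `L(W₁,1)/Ω(W₁)` a `p`-unit), or a second such step.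
Every decided instance so far (rungs #1–#3, slices, batches) exhibits ONE frame for ONE pair by residues.
This file proves the FRAME HALF of the crux CLASS-WIDE (uniformly in `(W, p)`):

* `exists_bcsAdmissiblePair` (**BCS 2025 Lemma 5.2.3 read into the route's predicate, kernel-checked**): for
  every globally minimal elliptic `W/ℚ`, prime `p ≥ 5` with `p ∤ N(W)` and bound `n` there is a
  BCS-admissible pair `(d_K, d_F)` with `d_K < -n`, `n < d_F`, and a quadratic field `K₀` of discriminant
  `d_K`. The `K`-side is `d_K = -q₁`, `q₁ ≡ -1 (mod 8·p·∏_{ℓ ∣ N} ℓ)` prime, with its field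
  (`Quadratic.exists_prime_and_field_discr_eq_neg`); the `F`-side is the Literature's arithmetic Lemma
  5.2.3 `exists_auxiliaryRealQuadraticDiscr` (CRT + Dirichlet + reciprocity, Jacobi symbols), translated
  by the landed bridge lemmas `splitsInQuadField_iff_jacobiSym_eq_one` / `inertInQuadField_iff_jacobiSym_eq_neg_one`
  / `splitsInQuadField_two_iff` / `inertInQuadField_two_iff`. So admissible frames are never the obstruction
  — infinitely many for every pair, in particular for every X9 pair (`exists_bcsAdmissiblePair_of_classX9`:
  `ClassX9 W p` gives `p ≥ 5` and good reduction at `p`, hence `p ∤ N(W)`).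
* `frameSupply_classX9` (**the crux body minus its analytic–Ш heart, class-wide**): for every X9 pair with
  `p ∤ ∏ c_ℓ(W)` and every `n`: an admissible frame with `d_K < -n`, `n < d_F`, a globally minimal elliptic
  `W₁` with `C • W₁ = W^{(d_K)}` (Néron), and `ClassX9 W₁ p ∧ p ∤ ∏ c_ℓ(W₁) ∧ p ∤ #W₁(ℚ)_tors` (twist
  stability; Jetchev–Skinner–Wan (eq:tamK) via `classX9_and_not_dvd_tamagawaProduct_of_frame`; torsion from
  irreducibility). NOT supplied — exactly the open content of the crux per frame (Prasanna 2010, p. 400) — is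
  `r_an(W₁) = 0 ∧ L(W₁,1)/Ω(W₁) ∈ ℤ_(p)^× ∧ p ∤ #Ш(W₁)` (or the second step); `cruxBody_of_heart` pins it.

HONEST FRAMING: BSD is NOT proved; `TrivialTwinSupplyX9` is NOT proved; nothing here is conditional. Helper
theorems (`--supports` item 24080); 0 definitions, 0 named facts, 0 sorry. References:
[BurungaleCastellaSkinner2025] §1.2, Prop. 5.2.1, Lemma 5.2.3; [JetchevSkinnerWan2017] §7.3.1;
[Prasanna2010CJM]; [SilvermanAEC2009] VIII.8; [Marcus1977] Ch. 3 Thm. 25.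
-/

set_option linter.dupNamespace false
set_option autoImplicit false

noncomputable section

open scoped Classical NumberField

open WeierstrassCurve Literature.NumberTheory.EllipticCurves
  Literature.NumberTheory.EllipticCurves.Rank1Residual.X11RankOneCertificates
  Summit.BirchSwinnertonDyer.Rank1Residual.X11b
  Summit.BirchSwinnertonDyer.BirchSwinnertonDyer.Rank1Residual.IntModel
  Summit.BirchSwinnertonDyer.BirchSwinnertonDyer.Rank1Residual
  Summit.BirchSwinnertonDyer.BirchSwinnertonDyer.Theses.TwinTransportX9
  Literature.NumberTheory.QuadraticFields.Quadratic

namespace Summit.BirchSwinnertonDyer.BirchSwinnertonDyer.Theorems.TwinTransportX9Rung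

/-! ## §1 The `K`-side residue witness -/

/-- An odd prime `ℓ` with `d ≡ 1 (mod ℓ)` splits in `ℚ(√d)` (`1` is a non-zero square) — the `K`-side
witness for `d_K = -q₁`, `q₁ ≡ -1 (mod ℓ)`. [cite: Marcus1977, Ch. 3 Thm. 25] -/
theorem splitsInQuadField_of_cast_eq_one {d : ℤ} {ℓ : ℕ} (hℓ : ℓ.Prime) (hℓ2 : ℓ ≠ 2)
    (h : (d : ZMod ℓ) = 1) : SplitsInQuadField d ℓ := by
  haveI := Fact.mk hℓ
  refine ⟨fun hdvd => ?_, fun h2 => absurd h2 hℓ2, fun _ => ⟨1, by rw [h, mul_one]⟩⟩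
  rw [(ZMod.intCast_zmod_eq_zero_iff_dvd d ℓ).mpr hdvd] at h
  exact zero_ne_one h

/-! ## §2 BCS-admissible frames exist for every pair (BCS 2025 Lemma 5.2.3, in the route's residue currency) -/

/-- **Admissible frames exist, infinitely many, for every `(W, p)` with `p ≥ 5` and `p ∤ N(W)`**
(Burungale–Castella–Skinner 2025, Lemma 5.2.3, read into the route's predicate `BCSAdmissiblePair`):
for every bound `n` there is a BCS-admissible pair `(d_K, d_F)` with `d_K < -n`, `n < d_F`, together with
a quadratic field `K₀` of discriminant `d_K`. Proof: `d_K = -q₁` with `q₁ ≡ -1 (mod 8·p·∏_{ℓ ∣ N} ℓ)` prime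
and `K₀ = ℚ(√-q₁)` (`Quadratic.exists_prime_and_field_discr_eq_neg`: Dirichlet + Minkowski), so that
`-q₁ ≡ 1` modulo `8`, `p` and every `ℓ ∣ N` ((disc), (Heeg), (spl)); then `d_F` from the Literature's
arithmetic Lemma 5.2.3 `exists_auxiliaryRealQuadraticDiscr` (CRT + Dirichlet + reciprocity, in Jacobi
symbols) at `M = N(W)`, translated by the bridge lemmas `splitsInQuadField_iff_jacobiSym_eq_one`,
`inertInQuadField_iff_jacobiSym_eq_neg_one`, `splitsInQuadField_two_iff`, `inertInQuadField_two_iff`.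
A THEOREM (no named fact is assumed). [cite: BurungaleCastellaSkinner2025, §1.2, Prop. 5.2.1 (i)–(vi), Lemma 5.2.3]
[cite: Marcus1977, Ch. 3 Thm. 25] -/
theorem exists_bcsAdmissiblePair (W : WeierstrassCurve ℚ) [W.IsElliptic] [W.IsGloballyMinimal]
    {p : ℕ} (hp : p.Prime) (hp5 : 5 ≤ p) (hpN : ¬ p ∣ W.conductorNorm ℤ) (n : ℕ) :
    ∃ dK dF : ℤ, BCSAdmissiblePair W p dK dF ∧ dK < -(n : ℤ) ∧ (n : ℤ) < dF ∧
      ∃ (K₀ : Type) (_ : Field K₀) (_ : NumberField K₀),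
        Module.finrank ℚ K₀ = 2 ∧ NumberField.discr K₀ = dK := by
  have hp2 : p ≠ 2 := by omega
  have hN0 : W.conductorNorm ℤ ≠ 0 := fun h => hpN (by rw [h]; exact dvd_zero p)
  -- Step 1: `q₁ ≡ -1 (mod 8 · p · ∏_{ℓ ∣ N} ℓ)` and the field `K₀ = ℚ(√-q₁)`
  obtain ⟨q₁, K₀, _, _, hq₁, hq₁n, hq₁8, hq₁res, hK₀2, hK₀d⟩ :=
    exists_prime_and_field_discr_eq_neg (insert p (W.conductorNorm ℤ).primeFactors) (n + W.conductorNorm ℤ + p + 3)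
  have hq₁2 : q₁ ≠ 2 := by omega
  have hq₁p : q₁ ≠ p := by omega
  have hq₁N : ¬ q₁ ∣ W.conductorNorm ℤ := fun h => by
    have := Nat.le_of_dvd (Nat.pos_of_ne_zero hN0) h; omega
  have hKsplit : ∀ ℓ ∈ insert p (W.conductorNorm ℤ).primeFactors, ℓ.Prime →
      SplitsInQuadField (-(q₁ : ℤ)) ℓ := by
    intro ℓ hℓ hℓp
    by_cases hℓ2 : ℓ = 2
    · subst hℓ2; exact splitsInQuadField_two_iff.mpr (by omega)
    · refine splitsInQuadField_of_cast_eq_one hℓp hℓ2 ?_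
      rw [Int.cast_neg, Int.cast_natCast, hq₁res ℓ hℓ hℓp.ne_zero, neg_neg]
  have hdisc : -(q₁ : ℤ) < 0 ∧ Squarefree (-(q₁ : ℤ)) ∧ -(q₁ : ℤ) % 4 = 1 ∧ -(q₁ : ℤ) ≠ -3 := by
    refine ⟨?_, ?_, by omega, by omega⟩
    · have := hq₁.pos; omega
    · rw [← Int.squarefree_natAbs]; simpa using hq₁.squarefree
  have hHeeg : ∀ ℓ : ℕ, ℓ.Prime → ℓ ∣ W.conductorNorm ℤ → SplitsInQuadField (-(q₁ : ℤ)) ℓ :=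
    fun ℓ hℓ hℓN => hKsplit ℓ (Finset.mem_insert_of_mem (Nat.mem_primeFactors.mpr ⟨hℓ, hℓN, hN0⟩)) hℓ
  have hspl : SplitsInQuadField (-(q₁ : ℤ)) p := hKsplit p (Finset.mem_insert_self _ _) hp
  -- Step 2: `d_F` by the Literature's Lemma 5.2.3 (real side), at `M = N(W)`, `d_K = -q₁`
  have hcop : (-(q₁ : ℤ)).natAbs.Coprime (2 * p * W.conductorNorm ℤ) := by
    rw [Int.natAbs_neg, Int.natAbs_natCast]
    exact Nat.Coprime.mul_right
      (Nat.Coprime.mul_right ((Nat.coprime_primes hq₁ Nat.prime_two).mpr hq₁2)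
        ((Nat.coprime_primes hq₁ hp).mpr hq₁p))
      ((Nat.Prime.coprime_iff_not_dvd hq₁).mpr hq₁N)
  obtain ⟨dF, hXF, hF1, hF4, hFsq, hFp, hFii, hFiii, hFvi⟩ :=
    exists_auxiliaryRealQuadraticDiscr p hp hp5 (W.conductorNorm ℤ) hN0 hpN (-(q₁ : ℤ))
      (by have := hq₁.pos; omega) hcop (Finset.Icc (-(n : ℤ)) n)
  have hnF : (n : ℤ) < dF := by
    by_contra h
    exact hXF (Finset.mem_Icc.mpr ⟨by omega, by omega⟩)
  -- translation of the Jacobi-symbol clauses into the route's residue predicates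
  have hi : InertInQuadField dF p := (inertInQuadField_iff_jacobiSym_eq_neg_one hp hp2).mpr hFp
  have hii : ∀ ℓ : ℕ, ℓ.Prime → (ℓ : ℤ) ∣ dF → SplitsInQuadField (-(q₁ : ℤ)) ℓ := by
    intro ℓ hℓ hℓd
    obtain ⟨h2, hodd⟩ := hFii ℓ hℓ hℓd
    by_cases hℓ2 : ℓ = 2
    · subst hℓ2; exact splitsInQuadField_two_iff.mpr (h2 rfl)
    · exact (splitsInQuadField_iff_jacobiSym_eq_one hℓ hℓ2).mpr (hodd hℓ2)
  have hiii : ∀ ℓ : ℕ, ℓ.Prime → ℓ ∣ W.conductorNorm ℤ →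
      (p ∣ ℓ + 1 → InertInQuadField dF ℓ) ∧ (¬ p ∣ ℓ + 1 → SplitsInQuadField dF ℓ) := by
    intro ℓ hℓ hℓN
    obtain ⟨hin, hsp⟩ := hFiii ℓ hℓ hℓN
    by_cases hℓ2 : ℓ = 2
    · subst hℓ2
      exact ⟨fun h => inertInQuadField_two_iff.mpr ((hin h).1 rfl),
        fun h => splitsInQuadField_two_iff.mpr ((hsp h).1 rfl)⟩
    · exact ⟨fun h => (inertInQuadField_iff_jacobiSym_eq_neg_one hℓ hℓ2).mpr ((hin h).2 hℓ2),
        fun h => (splitsInQuadField_iff_jacobiSym_eq_one hℓ hℓ2).mpr ((hsp h).2 hℓ2)⟩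
  -- assemble
  have hnK : -(q₁ : ℤ) < -(n : ℤ) := by omega
  have hadm : BCSAdmissiblePair W p (-(q₁ : ℤ)) dF :=
    ⟨hdisc, hHeeg, hspl, ⟨hF1, hFsq, hF4⟩, hi, hii, hiii, hFvi⟩
  have hK : ∃ (K : Type) (_ : Field K) (_ : NumberField K),
      Module.finrank ℚ K = 2 ∧ NumberField.discr K = -(q₁ : ℤ) :=
    ⟨K₀, inferInstance, inferInstance, hK₀2, hK₀d⟩
  exact ⟨-(q₁ : ℤ), dF, hadm, hnK, hnF, hK⟩

/-- **Admissible frames exist for every X9 pair** (infinitely many): `ClassX9 W p` gives `p ≥ 5` and good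
reduction at `p`, hence `p ∤ N(W)` (`not_dvd_conductorNorm_of_hasGoodReductionAtPrime`).
[cite: BurungaleCastellaSkinner2025, §1.2, Lemma 5.2.3] -/
theorem exists_bcsAdmissiblePair_of_classX9 (W : WeierstrassCurve ℚ) [W.IsElliptic] [W.IsGloballyMinimal]
    (p : ℕ) [Fact p.Prime] (hX9 : ClassX9 W p) (n : ℕ) :
    ∃ dK dF : ℤ, BCSAdmissiblePair W p dK dF ∧ dK < -(n : ℤ) ∧ (n : ℤ) < dF ∧
      ∃ (K₀ : Type) (_ : Field K₀) (_ : NumberField K₀),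
        Module.finrank ℚ K₀ = 2 ∧ NumberField.discr K₀ = dK := by
  exact exists_bcsAdmissiblePair W Fact.out hX9.2.1
    (not_dvd_conductorNorm_of_hasGoodReductionAtPrime W hX9.2.2.1) n

/-! ## §4 The crux body minus its analytic–Ш heart, class-wide -/

/-- **FRAME SUPPLY WITH THE CHEAP CONJUNCTS, CLASS-WIDE.** For every X9 pair `(W, p)` with `p ∤ ∏ c_ℓ(W)` and
every bound `n`: an admissible frame `(d_K, d_F)` with `d_K < -n < n < d_F`, a globally minimal elliptic `W₁`
with `C • W₁ = W^{(d_K)}` (Néron), and `ClassX9 W₁ p ∧ p ∤ ∏ c_ℓ(W₁) ∧ p ∤ #W₁(ℚ)_tors` (twist stability,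
Jetchev–Skinner–Wan (eq:tamK) with vacuous bad-prime clause, irreducibility of `ρ̄_{W₁,p}`). This is the body
of `TrivialTwinSupplyX9` at `(W, p)` with the conjuncts `r_an(W₁) = 0`, `p ∤ #Ш(W₁)`, "`L(W₁,1)/Ω(W₁)` a
`p`-unit" (resp. the second step) REMOVED — those are the crux's open content (Prasanna 2010 p. 400). BSD is
NOT proved; the crux is NOT proved. [cite: BurungaleCastellaSkinner2025, §1.2, Prop. 5.2.1, Lemma 5.2.3]
[cite: JetchevSkinnerWan2017, §7.3.1 (eq:tamK)] [cite: SilvermanAEC2009, VIII.8 Cor. 8.3]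
[cite: Prasanna2010CJM, p. 400 (Introduction)] -/
theorem frameSupply_classX9 (W : WeierstrassCurve ℚ) [W.IsElliptic] [W.IsGloballyMinimal]
    (p : ℕ) [Fact p.Prime] (hX9 : ClassX9 W p) (hTam : ¬ p ∣ W.tamagawaProduct) (n : ℕ) :
    ∃ dK dF : ℤ, BCSAdmissiblePair W p dK dF ∧ dK < -(n : ℤ) ∧ (n : ℤ) < dF ∧
      ∃ (W₁ : WeierstrassCurve ℚ) (_ : W₁.IsElliptic) (_ : W₁.IsGloballyMinimal),
        (∃ C : WeierstrassCurve.VariableChange ℚ, C • W₁ = W.quadraticTwist (dK : ℚ)) ∧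
        ClassX9 W₁ p ∧ ¬ p ∣ W₁.tamagawaProduct ∧ ¬ p ∣ W₁.torsionOrder := by
  have hp : p.Prime := Fact.out
  obtain ⟨dK, dF, hadm, hdKn, hdFn, K₀, _, _, hK₀2, hK₀d⟩ := exists_bcsAdmissiblePair_of_classX9 W p hX9 n
  have hdQ : (dK : ℚ) ≠ 0 := by exact_mod_cast hadm.1.1.ne
  haveI iT : (W.quadraticTwist (dK : ℚ)).IsElliptic := isElliptic_quadraticTwist _ hdQ
  obtain ⟨C, hC⟩ := hasGlobalMinimalModel_rat_holds (W.quadraticTwist (dK : ℚ))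
  haveI := hC
  have hCW : C⁻¹ • (C • W.quadraticTwist (dK : ℚ)) = W.quadraticTwist (dK : ℚ) := inv_smul_smul C _
  obtain ⟨hX9₁, hTam₁⟩ :=
    classX9_and_not_dvd_tamagawaProduct_of_frame W hadm hK₀2 hK₀d (C • W.quadraticTwist (dK : ℚ)) hCW hX9 hTam
  have htors : ¬ p ∣ (C • W.quadraticTwist (dK : ℚ)).torsionOrder :=
    not_dvd_of_padicValNat_eq_zero hp (C • W.quadraticTwist (dK : ℚ)).torsionOrder_pos_holds
      (Rank1Residual.padicValNat_torsionOrder_eq_zero_of_irreducible _ p hX9₁.2.2.2.2.1)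
  exact ⟨dK, dF, hadm, hdKn, hdFn, C • W.quadraticTwist (dK : ℚ), inferInstance, hC, ⟨C⁻¹, hCW⟩,
    hX9₁, hTam₁, htors⟩

/-- **What remains of the crux per pair, after the frame supply** (bookkeeping, by `rung_of_frame'`-style
assembly): `TrivialTwinSupplyX9` at `(W, p)` follows from the frame supply as soon as ONE admissible frame's
minimal twin `W₁` carries the first-disjunct certificate `r_an(W₁) = 0 ∧ p ∤ #Ш(W₁) ∧ L(W₁,1)/Ω(W₁)` a
`p`-unit (with `p ∤ ∏c_ℓ(W₁)·#tors` supplied class-wide above). Stated as the trivial re-packaging it is, to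
pin the open content: the hypothesis `hheart`. BSD is NOT proved. [cite: Prasanna2010CJM, p. 400 (Introduction)]
[cite: BurungaleCastellaSkinner2025, §1.2, Prop. 5.2.1] -/
theorem cruxBody_of_heart (W : WeierstrassCurve ℚ) [W.IsElliptic] [W.IsGloballyMinimal]
    (p : ℕ) [Fact p.Prime] {dK dF : ℤ} (hadm : BCSAdmissiblePair W p dK dF)
    (W₁ : WeierstrassCurve ℚ) [W₁.IsElliptic] [W₁.IsGloballyMinimal] {C : VariableChange ℚ}
    (hC : C • W₁ = W.quadraticTwist (dK : ℚ)) (hX9₁ : ClassX9 W₁ p) (hTam₁ : ¬ p ∣ W₁.tamagawaProduct)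
    (hheart : W₁.analyticRank = 0 ∧ ¬ p ∣ W₁.shaOrder ∧
      ∃ q : ℚ, W₁.leadingLCoeff / (W₁.realPeriodRat : ℂ) = (q : ℂ) ∧ padicValRat p q = 0) :
    ∃ dK dF : ℤ, BCSAdmissiblePair W p dK dF ∧
      ∃ (W₁ : WeierstrassCurve ℚ) (_ : W₁.IsElliptic) (_ : W₁.IsGloballyMinimal),
        (∃ C : WeierstrassCurve.VariableChange ℚ, C • W₁ = W.quadraticTwist (dK : ℚ)) ∧
        ((W₁.analyticRank = 0 ∧ ¬ p ∣ W₁.shaOrder ∧ ¬ p ∣ W₁.tamagawaProduct ∧ ¬ p ∣ W₁.torsionOrder ∧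
            ∃ q : ℚ, W₁.leadingLCoeff / (W₁.realPeriodRat : ℂ) = (q : ℂ) ∧ padicValRat p q = 0) ∨
          ∃ dK' dF' : ℤ, BCSAdmissiblePair W₁ p dK' dF' ∧
            ∃ (W₂ : WeierstrassCurve ℚ) (_ : W₂.IsElliptic) (_ : W₂.IsGloballyMinimal),
              (∃ C : WeierstrassCurve.VariableChange ℚ, C • W₂ = W₁.quadraticTwist (dK' : ℚ)) ∧
              (W₂.analyticRank = 0 ∧ ¬ p ∣ W₂.shaOrder ∧ ¬ p ∣ W₂.tamagawaProduct ∧ ¬ p ∣ W₂.torsionOrder ∧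
                ∃ q : ℚ, W₂.leadingLCoeff / (W₂.realPeriodRat : ℂ) = (q : ℂ) ∧ padicValRat p q = 0)) := by
  have hp : p.Prime := Fact.out
  have htors : ¬ p ∣ W₁.torsionOrder :=
    not_dvd_of_padicValNat_eq_zero hp W₁.torsionOrder_pos_holds
      (Rank1Residual.padicValNat_torsionOrder_eq_zero_of_irreducible _ p hX9₁.2.2.2.2.1)
  obtain ⟨hr, hsha, hq⟩ := hheart
  exact ⟨dK, dF, hadm, W₁, ‹_›, ‹_›, ⟨C, hC⟩, Or.inl ⟨hr, hsha, hTam₁, htors, hq⟩⟩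

end Summit.BirchSwinnertonDyer.BirchSwinnertonDyer.Theorems.TwinTransportX9Rung
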